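import Summits.QuantumFields.YangMills.Theorems.FradkinShenkerFlowFiniteSusceptibilityWeakCouplingEvenReduction
import HarnessLib

/-!
# Polarisation of the connected time-correlator (item stmt-QuantumFields-9442, line `purity-rate-split`)

Support file for item stmt-QuantumFields-9442 (route `FradkinShenkerFlow` of `YangMills`), crux
`Summit.QuantumFields.YangMills.Theses.FradkinShenkerFlow.FiniteSusceptibilityWeakCoupling`, line `purity-rate-split`,
registered stub `stub_connectedCorrPolarisation`. Write `K(X,Y)(n) = ⟨X · τ_{n e₀} Y⟩_{β,2S+1} − ⟨X⟩⟨Y⟩`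
(`latticeConnectedCorr` on the odd torus of side `2S+1`). For species `A, P, M` with `P + M = 2A` pointwise,

  `4·K(A,A) = K(P,P) + K(M,M) + K(P,M) + K(M,P)`

for every compact `G`, every real `β`, every `S, n` — pure bilinearity of the covariance (`A = ½(P + M)` on both
slots), after identifying `K` with the Mathlib covariance of the lifted species under the torus Wilson state
(`SiblingFunnel.covariance_eq_latticeConnectedCorr`). The lead uses it with `P = A + A∘θ_k`, `M = A − A∘θ_k`.

No definition is introduced; nothing here is a named fact. [folklore]
-/

noncomputable section

open MeasureTheory ProbabilityTheory Finset
open Literature.MathematicalPhysics.QuantumFieldTheory hiding Site ZdEdge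
open Literature.MathematicalPhysics.QuantumLattice
open Literature.Probability.LatticeModels hiding configShift configShift_apply

namespace Summit.QuantumFields.YangMills.Theorems.FiniteSusceptibilityWeakCoupling

namespace Polarisation

variable {G : Type} [Group G] [TopologicalSpace G] [IsTopologicalGroup G] [CompactSpace G]
  [MeasurableSpace G] [BorelSpace G]

/-- **`4·K(A,A) = K(P,P) + K(M,M) + K(P,M) + K(M,P)`** whenever `P + M = 2A` pointwise (as species): bilinearity of the
covariance, `A = ½(P + M)` in both slots. Every real `β`, every compact `G`. [folklore] -/
theorem four_mul_corr_eq (r : LatticeRep G) (β : ℝ) (A P M : YMSpecies G)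
    (h : ∀ V, P.F V + M.F V = 2 * A.F V) (S n : ℕ) :
    4 * latticeConnectedCorr r.ρ β (2 * S + 1) A.F A.F n =
      latticeConnectedCorr r.ρ β (2 * S + 1) P.F P.F n + latticeConnectedCorr r.ρ β (2 * S + 1) M.F M.F n +
        latticeConnectedCorr r.ρ β (2 * S + 1) P.F M.F n + latticeConnectedCorr r.ρ β (2 * S + 1) M.F P.F n := by
  -- adapted from `EvenReduction.four_mul_mirrorCorr_eq` (same bilinearity bookkeeping, no reflection)
  haveI : IsProbabilityMeasure (wilsonMeasure (d := 4) (L := 2 * S + 1) r.ρ β) :=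
    isProbabilityMeasure_wilsonMeasure _ r.continuous β
  rw [← SiblingFunnel.covariance_eq_latticeConnectedCorr r β A A S n,
    ← SiblingFunnel.covariance_eq_latticeConnectedCorr r β P P S n,
    ← SiblingFunnel.covariance_eq_latticeConnectedCorr r β M M S n,
    ← SiblingFunnel.covariance_eq_latticeConnectedCorr r β P M S n,
    ← SiblingFunnel.covariance_eq_latticeConnectedCorr r β M P S n]
  set fP : GaugeConfig 4 (2 * S + 1) G → ℝ := fun U => P.F (torusLift (2 * S + 1) U) with hfP
  set fM : GaugeConfig 4 (2 * S + 1) G → ℝ := fun U => M.F (torusLift (2 * S + 1) U) with hfM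
  set gP : GaugeConfig 4 (2 * S + 1) G → ℝ :=
    fun U => P.F (configShift (-(Pi.single 0 (n : ℤ))) (torusLift (2 * S + 1) U)) with hgP
  set gM : GaugeConfig 4 (2 * S + 1) G → ℝ :=
    fun U => M.F (configShift (-(Pi.single 0 (n : ℤ))) (torusLift (2 * S + 1) U)) with hgM
  have hfA : (fun U : GaugeConfig 4 (2 * S + 1) G => A.F (torusLift (2 * S + 1) U)) =
      (1 / 2 : ℝ) • (fP + fM) := by
    funext U
    simp only [hfP, hfM, Pi.smul_apply, Pi.add_apply, smul_eq_mul]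
    linarith [h (torusLift (2 * S + 1) U)]
  have hgA : (fun U : GaugeConfig 4 (2 * S + 1) G =>
      A.F (configShift (-(Pi.single 0 (n : ℤ))) (torusLift (2 * S + 1) U))) =
      (1 / 2 : ℝ) • (gP + gM) := by
    funext U
    simp only [hgP, hgM, Pi.smul_apply, Pi.add_apply, smul_eq_mul]
    linarith [h (configShift (-(Pi.single 0 (n : ℤ))) (torusLift (2 * S + 1) U))]
  have mfP : MemLp fP 2 (wilsonMeasure (d := 4) (L := 2 * S + 1) r.ρ β) := EvenReduction.memLp_lift r β P S
  have mfM : MemLp fM 2 (wilsonMeasure (d := 4) (L := 2 * S + 1) r.ρ β) := EvenReduction.memLp_lift r β M S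
  have mgP : MemLp gP 2 (wilsonMeasure (d := 4) (L := 2 * S + 1) r.ρ β) :=
    EvenReduction.memLp_shift_lift r β P S _
  have mgM : MemLp gM 2 (wilsonMeasure (d := 4) (L := 2 * S + 1) r.ρ β) :=
    EvenReduction.memLp_shift_lift r β M S _
  rw [hfA, hgA, covariance_smul_left, covariance_smul_right, covariance_add_left mfP mfM (mgP.add mgM),
    covariance_add_right mfP mgP mgM, covariance_add_right mfM mgP mgM]
  ring

end Polarisation

/-- **Registered sub-goal `stub_connectedCorrPolarisation`** of item stmt-QuantumFields-9442 (signature verbatim, fully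
qualified) — **polarisation of the connected time-correlator** (line `purity-rate-split`): for every compact `G`, every
real `β` and species `A, P, M` with `P + M = 2A` pointwise, `4·K(A,A) = K(P,P) + K(M,M) + K(P,M) + K(M,P)` on every odd
torus and at every lag — bilinearity of the covariance (`Polarisation.four_mul_corr_eq`). [folklore] -/
theorem stub_connectedCorrPolarisation : ∀ (G : Type) [Group G] [TopologicalSpace G] [IsTopologicalGroup G] [CompactSpace G] [MeasurableSpace G] [BorelSpace G] (r : Literature.MathematicalPhysics.QuantumFieldTheory.LatticeRep G) (β : ℝ) (A P M : Literature.MathematicalPhysics.QuantumFieldTheory.YMSpecies G), (∀ V, P.F V + M.F V = 2 * A.F V) → ∀ S n : ℕ, 4 * Literature.MathematicalPhysics.QuantumFieldTheory.latticeConnectedCorr r.ρ β (2 * S + 1) A.F A.F n = Literature.MathematicalPhysics.QuantumFieldTheory.latticeConnectedCorr r.ρ β (2 * S + 1) P.F P.F n + Literature.MathematicalPhysics.QuantumFieldTheory.latticeConnectedCorr r.ρ β (2 * S + 1) M.F M.F n + Literature.MathematicalPhysics.QuantumFieldTheory.latticeConnectedCorr r.ρ β (2 * S + 1) P.F M.F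 n + Literature.MathematicalPhysics.QuantumFieldTheory.latticeConnectedCorr r.ρ β (2 * S + 1) M.F P.F n := by
  intro G _ _ _ _ _ _ r β A P M h S n
  exact Polarisation.four_mul_corr_eq r β A P M h S n

end Summit.QuantumFields.YangMills.Theorems.FiniteSusceptibilityWeakCoupling

end
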